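import Mathlib.Analysis.SpecialFunctions.Trigonometric.Bounds
import Mathlib.Analysis.Complex.Trigonometric
import Mathlib.Analysis.Real.Pi.Bounds
import Literature.Geometry.DiscreteGeometry.SphericalPolygonArea
import Literature.Geometry.DiscreteGeometry.SphericalExcessMonotone
import Literature.Geometry.DiscreteGeometry.ConeTiling
import HarnessLib

/-!
# Fans of trihedral cones with integer generators: the certificate toolkit for `stub_censusCert`
# (route `HullExactificationCascade`, crux `ZeroDefectDensity`, stmt-AtomisticToContinuum-12086)

Support file (lead c5, worker K2a) for the purely computational leaf `stub_censusCert` of the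
Voronoi-type area census: two FIXED regions of the unit ball of `ℝ³` (a cap of cos-radius `893/1250`
cut by one, resp. two, planes through the origin) get their ball fractions bounded by fans of
trihedral cones `T(a, b, c) = {det[b;c;·] ≥ 0} ∩ {det[c;a;·] ≥ 0} ∩ {det[a;b;·] ≥ 0}` whose
generators are INTEGER vectors of INTEGER length (Pythagorean quadruples `(x, y, z, n)`,
`x² + y² + z² = n²`, carried around as `ℤ × ℤ × ℤ × ℕ`), so that every side cosine is rational
and Euler's formula `1 − cos E = F` (`Literature.….one_sub_cos_sphExcess`) turns each solid angle
`E = 4π · ballFraction 0 T` (Girard, `ballFraction_orient3_inter₃`) into a rational number up to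
`cos`.  This file is the region-independent analysis:

* `sphExcess_smul` (the excess is invariant under positive rescaling of the three generators) and
  `sphExcess_le_of_cos_le` (UPPER bounds for the excess from Euler's function: the companion of the
  tree's `le_sphExcess_of_one_sub_cos_le`; `E ≤ π` is obtained from `sin E ≥ 0`, `cos E < 1`);
* `le_sphExcess_of_norms` / `sphExcess_le_of_norms`: the two bounds with all denominators cleared,
  for generators of prescribed norms — polynomial inequalities in the norms and the three inner
  products (`1 − x²/2 ≤ cos x`, resp. `cos x ≤ 1 − x²/2 + (5/96)x⁴` from `Real.cos_bound`);
* the same for integer generators `(x, y, z, n)` with the bounds `p/10¹⁵` read off INTEGER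
  inequalities (`le_sphExcess_ivec`, `sphExcess_ivec_le`), plus the cast lemmas `inner_ivec`,
  `orient3_ivec`, `orient3_ivec_right`, `norm_ivec` (a Pythagorean quadruple has integer norm).

The trihedral cones, the measure glue and the two model regions are in the sequel
`…CensusCertTri.lean`; the two fans in `…CensusCertSeg.lean`, `…CensusCertOv.lean`; the data in
`…CensusCert.lean`.  No definitions; folklore spherical trigonometry and bookkeeping.
-/

noncomputable section

namespace Summit.AtomisticToContinuum.Crystallization.Theorems.ZeroDefectDensityBirth

open Real RealInnerProductSpace InnerProductGeometry MeasureTheory Metric Set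
open Literature.Geometry.DiscreteGeometry

/-! ### Scaling invariance of the excess; upper bounds from Euler's function -/

section Excess

variable {F : Type*} [NormedAddCommGroup F] [InnerProductSpace ℝ F]

/-- `perpTo` does not see a nonzero rescaling of the axis: `perpTo (r • a) b = perpTo a b`.
[folklore] -/
theorem perpTo_smul_left (a b : F) {r : ℝ} (hr : r ≠ 0) : perpTo (r • a) b = perpTo a b := by
  unfold perpTo
  rcases eq_or_ne a 0 with rfl | ha
  · simp
  · have haa : ⟪a, a⟫ ≠ 0 := fun h => ha (inner_self_eq_zero.1 h)
    rw [real_inner_smul_left, real_inner_smul_left, real_inner_smul_right, smul_smul]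
    congr 1
    field_simp

/-- **The spherical excess is invariant under positive rescaling of the three generators**
(it only depends on the three rays). [folklore] -/
theorem sphExcess_smul (a b c : F) {r s t : ℝ} (hr : 0 < r) (hs : 0 < s) (ht : 0 < t) :
    sphExcess (r • a) (s • b) (t • c) = sphExcess a b c := by
  simp only [sphExcess, perpTo_smul_left _ _ hr.ne', perpTo_smul_left _ _ hs.ne',
    perpTo_smul_left _ _ ht.ne', perpTo_smul_right, angle_smul_left_of_pos _ _ hr,
    angle_smul_left_of_pos _ _ hs, angle_smul_right_of_pos _ _ hs, angle_smul_right_of_pos _ _ ht]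

/-- **Upper bounds for the excess from Euler's function.**  For linearly independent unit vectors
of `ℝ³` with `1 + x + y + z ≥ 0` (so `sin E ≥ 0`, `sin_sphExcess`) and `F > 0` (so `cos E < 1`),
the excess `E` lies in `(0, π]`; hence `cos e ≤ 1 − F = cos E` with `0 ≤ e` gives `E ≤ e`.
[folklore] -/
theorem sphExcess_le_of_cos_le {a b c : EuclideanSpace ℝ (Fin 3)} (ha : ‖a‖ = 1) (hb : ‖b‖ = 1)
    (hc : ‖c‖ = 1) (hli : LinearIndependent ℝ ![a, b, c])
    (hsum : 0 ≤ 1 + ⟪b, c⟫ + ⟪a, c⟫ + ⟪a, b⟫) (hF : 0 < eulerF ⟪b, c⟫ ⟪a, c⟫ ⟪a, b⟫) {e : ℝ}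
    (he0 : 0 ≤ e) (hcos : Real.cos e ≤ 1 - eulerF ⟪b, c⟫ ⟪a, c⟫ ⟪a, b⟫) :
    sphExcess a b c ≤ e := by
  set E := sphExcess a b c with hEdef
  have hE : 1 - Real.cos E = eulerF ⟪b, c⟫ ⟪a, c⟫ ⟪a, b⟫ := one_sub_cos_sphExcess ha hb hc hli
  have hcosE : Real.cos E < 1 := by linarith
  have hx1 : ⟪b, c⟫ ^ 2 < 1 :=
    inner_sq_lt_one_of_linearIndependent hb hc (linearIndependent_pair_of_triple₂₃ hli)
  have hy1 : ⟪a, c⟫ ^ 2 < 1 :=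
    inner_sq_lt_one_of_linearIndependent ha hc (linearIndependent_pair_of_triple₁₃ hli)
  have hz1 : ⟪a, b⟫ ^ 2 < 1 :=
    inner_sq_lt_one_of_linearIndependent ha hb (linearIndependent_pair_of_triple₁₂ hli)
  have hxb := abs_lt.1 ((sq_lt_one_iff_abs_lt_one _).1 hx1)
  have hyb := abs_lt.1 ((sq_lt_one_iff_abs_lt_one _).1 hy1)
  have hzb := abs_lt.1 ((sq_lt_one_iff_abs_lt_one _).1 hz1)
  have hden : 0 < (1 + ⟪b, c⟫) * (1 + ⟪a, c⟫) * (1 + ⟪a, b⟫) :=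
    mul_pos (mul_pos (by linarith) (by linarith)) (by linarith)
  have hsin : 0 ≤ Real.sin E := by
    rw [hEdef, sin_sphExcess ha hb hc hli]
    exact div_nonneg (mul_nonneg hsum (Real.sqrt_nonneg _)) hden.le
  have hE2π : E ≤ 2 * π := by
    rw [hEdef, sphExcess]
    linarith [angle_le_pi (perpTo a b) (perpTo a c), angle_le_pi (perpTo b a) (perpTo b c),
      angle_le_pi (perpTo c a) (perpTo c b)]
  have hEπ : E ≤ π := by
    by_contra hlt
    push Not at hlt
    rcases lt_or_eq_of_le hE2π with h2 | h2
    · have : 0 < Real.sin (E - π) := Real.sin_pos_of_pos_of_lt_pi (by linarith) (by linarith)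
      rw [Real.sin_sub_pi] at this
      linarith
    · rw [h2, Real.cos_two_pi] at hcosE
      exact lt_irrefl _ hcosE
  by_contra hlt
  push Not at hlt
  have := Real.cos_lt_cos_of_nonneg_of_le_pi he0 hEπ hlt
  linarith

end Excess

/-! ### The two bounds with denominators cleared, for generators of prescribed norms -/

section Norms

/-- Euler's function at the side cosines `X/(nb nc), Y/(na nc), Z/(na nb)` with denominators
cleared: `F = G/H`, `G = na²nb²nc² − na²X² − nb²Y² − nc²Z² + 2XYZ` (the Gram determinant),
`H = (nb nc + X)(na nc + Y)(na nb + Z)`. [folklore] -/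
theorem eulerF_div_norms {na nb nc X Y Z : ℝ} (hna : 0 < na) (hnb : 0 < nb) (hnc : 0 < nc) :
    eulerF (X / (nb * nc)) (Y / (na * nc)) (Z / (na * nb)) =
      (na ^ 2 * nb ^ 2 * nc ^ 2 - na ^ 2 * X ^ 2 - nb ^ 2 * Y ^ 2 - nc ^ 2 * Z ^ 2 + 2 * X * Y * Z) /
        ((nb * nc + X) * (na * nc + Y) * (na * nb + Z)) := by
  have h1 : (1 + X / (nb * nc)) * (1 + Y / (na * nc)) * (1 + Z / (na * nb)) =
      (nb * nc + X) * (na * nc + Y) * (na * nb + Z) / (na * nb * nc) ^ 2 := by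
    field_simp
  have h2 : eulerGram (X / (nb * nc)) (Y / (na * nc)) (Z / (na * nb)) =
      (na ^ 2 * nb ^ 2 * nc ^ 2 - na ^ 2 * X ^ 2 - nb ^ 2 * Y ^ 2 - nc ^ 2 * Z ^ 2 + 2 * X * Y * Z) /
        (na * nb * nc) ^ 2 := by
    unfold eulerGram
    field_simp
  have hP : (na * nb * nc) ^ 2 ≠ 0 := by positivity
  rw [eulerF, h1, h2, div_div_div_cancel_right₀ hP]

variable {a b c : EuclideanSpace ℝ (Fin 3)} {na nb nc X Y Z : ℝ}

/-- Normalising three vectors of positive norms `na, nb, nc`: the unit vectors, their inner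
products, linear independence from a nonzero determinant, and the unchanged excess. [folklore] -/
theorem unit_data (hna : 0 < na) (hnb : 0 < nb) (hnc : 0 < nc) (ha : ‖a‖ = na) (hb : ‖b‖ = nb)
    (hc : ‖c‖ = nc) (hX : ⟪b, c⟫ = X) (hY : ⟪a, c⟫ = Y) (hZ : ⟪a, b⟫ = Z)
    (hdet : orient3 a b c ≠ 0) :
    ‖na⁻¹ • a‖ = 1 ∧ ‖nb⁻¹ • b‖ = 1 ∧ ‖nc⁻¹ • c‖ = 1 ∧
      ⟪nb⁻¹ • b, nc⁻¹ • c⟫ = X / (nb * nc) ∧ ⟪na⁻¹ • a, nc⁻¹ • c⟫ = Y / (na * nc) ∧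
      ⟪na⁻¹ • a, nb⁻¹ • b⟫ = Z / (na * nb) ∧
      LinearIndependent ℝ ![na⁻¹ • a, nb⁻¹ • b, nc⁻¹ • c] ∧
      sphExcess (na⁻¹ • a) (nb⁻¹ • b) (nc⁻¹ • c) = sphExcess a b c := by
  refine ⟨?_, ?_, ?_, ?_, ?_, ?_, ?_, sphExcess_smul a b c (inv_pos.2 hna) (inv_pos.2 hnb)
    (inv_pos.2 hnc)⟩
  · rw [norm_smul, norm_inv, norm_of_nonneg hna.le, ha, inv_mul_cancel₀ hna.ne']
  · rw [norm_smul, norm_inv, norm_of_nonneg hnb.le, hb, inv_mul_cancel₀ hnb.ne']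
  · rw [norm_smul, norm_inv, norm_of_nonneg hnc.le, hc, inv_mul_cancel₀ hnc.ne']
  · rw [real_inner_smul_left, real_inner_smul_right, hX]; field_simp
  · rw [real_inner_smul_left, real_inner_smul_right, hY]; field_simp
  · rw [real_inner_smul_left, real_inner_smul_right, hZ]; field_simp
  · refine linearIndependent_of_orient3_ne_zero ?_
    rw [orient3_smul_left, orient3_smul_mid, orient3_smul_right]
    exact mul_ne_zero (inv_ne_zero hna.ne') (mul_ne_zero (inv_ne_zero hnb.ne')
      (mul_ne_zero (inv_ne_zero hnc.ne') hdet))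

/-- **Lower bound for the excess, denominators cleared.**  For `a, b, c` of norms `na, nb, nc`,
inner products `⟪b,c⟫ = X, ⟪a,c⟫ = Y, ⟪a,b⟫ = Z` and nonzero determinant:
`e² · H ≤ 2 G` with `e ≤ π`, `H > 0` implies `e ≤ sphExcess a b c`
(`1 − cos e ≤ e²/2 ≤ G/H = F`). [folklore] -/
theorem le_sphExcess_of_norms (hna : 0 < na) (hnb : 0 < nb) (hnc : 0 < nc) (ha : ‖a‖ = na)
    (hb : ‖b‖ = nb) (hc : ‖c‖ = nc) (hX : ⟪b, c⟫ = X) (hY : ⟪a, c⟫ = Y) (hZ : ⟪a, b⟫ = Z)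
    (hdet : orient3 a b c ≠ 0) {e : ℝ} (heπ : e ≤ π)
    (hH : 0 < (nb * nc + X) * (na * nc + Y) * (na * nb + Z))
    (h : e ^ 2 * ((nb * nc + X) * (na * nc + Y) * (na * nb + Z)) ≤
      2 * (na ^ 2 * nb ^ 2 * nc ^ 2 - na ^ 2 * X ^ 2 - nb ^ 2 * Y ^ 2 - nc ^ 2 * Z ^ 2 +
        2 * X * Y * Z)) :
    e ≤ sphExcess a b c := by
  obtain ⟨h1, h2, h3, hx, hy, hz, hli, hE⟩ := unit_data hna hnb hnc ha hb hc hX hY hZ hdet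
  rw [← hE]
  refine le_sphExcess_of_one_sub_cos_le h1 h2 h3 hli heπ ?_
  rw [hx, hy, hz, eulerF_div_norms hna hnb hnc, le_div_iff₀ hH]
  have hc := Real.one_sub_sq_div_two_le_cos (x := e)
  nlinarith

/-- **Upper bound for the excess, denominators cleared.**  With the same data,
`na nb nc + na X + nb Y + nc Z ≥ 0`, `G > 0`, `H > 0`, `0 ≤ e ≤ 1` and
`96 G ≤ H (48 e² − 5 e⁴)` imply `sphExcess a b c ≤ e`
(`cos e ≤ 1 − e²/2 + (5/96) e⁴ ≤ 1 − G/H`, `Real.cos_bound`). [folklore] -/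
theorem sphExcess_le_of_norms (hna : 0 < na) (hnb : 0 < nb) (hnc : 0 < nc) (ha : ‖a‖ = na)
    (hb : ‖b‖ = nb) (hc : ‖c‖ = nc) (hX : ⟪b, c⟫ = X) (hY : ⟪a, c⟫ = Y) (hZ : ⟪a, b⟫ = Z)
    (hdet : orient3 a b c ≠ 0) {e : ℝ} (he0 : 0 ≤ e) (he1 : e ≤ 1)
    (hsum : 0 ≤ na * nb * nc + na * X + nb * Y + nc * Z)
    (hG : 0 < na ^ 2 * nb ^ 2 * nc ^ 2 - na ^ 2 * X ^ 2 - nb ^ 2 * Y ^ 2 - nc ^ 2 * Z ^ 2 +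
      2 * X * Y * Z)
    (hH : 0 < (nb * nc + X) * (na * nc + Y) * (na * nb + Z))
    (h : 96 * (na ^ 2 * nb ^ 2 * nc ^ 2 - na ^ 2 * X ^ 2 - nb ^ 2 * Y ^ 2 - nc ^ 2 * Z ^ 2 +
      2 * X * Y * Z) ≤ (nb * nc + X) * (na * nc + Y) * (na * nb + Z) * (48 * e ^ 2 - 5 * e ^ 4)) :
    sphExcess a b c ≤ e := by
  obtain ⟨h1, h2, h3, hx, hy, hz, hli, hE⟩ := unit_data hna hnb hnc ha hb hc hX hY hZ hdet
  rw [← hE]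
  have hF := eulerF_div_norms (X := X) (Y := Y) (Z := Z) hna hnb hnc
  refine sphExcess_le_of_cos_le h1 h2 h3 hli ?_ ?_ he0 ?_
  · rw [hx, hy, hz]
    have : 1 + X / (nb * nc) + Y / (na * nc) + Z / (na * nb) =
        (na * nb * nc + na * X + nb * Y + nc * Z) / (na * nb * nc) := by
      field_simp
    rw [this]
    positivity
  · rw [hx, hy, hz, hF]
    positivity
  · rw [hx, hy, hz, hF]
    have hcb := Real.cos_bound (x := e) (by rw [abs_of_nonneg he0]; exact he1)
    rw [abs_of_nonneg he0] at hcb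
    have hc1 := (abs_le.1 hcb).2
    have key : (na ^ 2 * nb ^ 2 * nc ^ 2 - na ^ 2 * X ^ 2 - nb ^ 2 * Y ^ 2 - nc ^ 2 * Z ^ 2 +
        2 * X * Y * Z) / ((nb * nc + X) * (na * nc + Y) * (na * nb + Z)) ≤
        e ^ 2 / 2 - e ^ 4 * (5 / 96) := by
      rw [div_le_iff₀ hH]
      nlinarith
    linarith

end Norms

/-! ### Integer generators `(x, y, z, n) : ℤ × ℤ × ℤ × ℕ` -/

section IntVec

/-- Inner products of integer vectors, in coordinates. -/
theorem inner_ivec (p q : ℤ × ℤ × ℤ × ℕ) :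
    ⟪(WithLp.toLp 2 ![(p.1 : ℝ), (p.2.1 : ℝ), (p.2.2.1 : ℝ)] : EuclideanSpace ℝ (Fin 3)), (WithLp.toLp 2 ![(q.1 : ℝ), (q.2.1 : ℝ), (q.2.2.1 : ℝ)] : EuclideanSpace ℝ (Fin 3))⟫ = (((p.1 * q.1 + p.2.1 * q.2.1 + p.2.2.1 * q.2.2.1) : ℤ) : ℝ) := by
  simp [PiLp.inner_apply, Fin.sum_univ_three]
  ring

/-- Determinants of integer vectors are the integer determinants. -/
theorem orient3_ivec (p q r : ℤ × ℤ × ℤ × ℕ) :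
    orient3 (WithLp.toLp 2 ![(p.1 : ℝ), (p.2.1 : ℝ), (p.2.2.1 : ℝ)] : EuclideanSpace ℝ (Fin 3)) (WithLp.toLp 2 ![(q.1 : ℝ), (q.2.1 : ℝ), (q.2.2.1 : ℝ)] : EuclideanSpace ℝ (Fin 3)) (WithLp.toLp 2 ![(r.1 : ℝ), (r.2.1 : ℝ), (r.2.2.1 : ℝ)] : EuclideanSpace ℝ (Fin 3)) =
      (((p.1 * (q.2.1 * r.2.2.1 - q.2.2.1 * r.2.1) - p.2.1 * (q.1 * r.2.2.1 - q.2.2.1 * r.1) + p.2.2.1 * (q.1 * r.2.1 - q.2.1 * r.1)) : ℤ) : ℝ) := by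
  simp [orient3]

/-- `det[p; q; x]` is the pairing of `x` with the integer cross product `p × q`. -/
theorem orient3_ivec_right (p q : ℤ × ℤ × ℤ × ℕ) (x : EuclideanSpace ℝ (Fin 3)) :
    orient3 (WithLp.toLp 2 ![(p.1 : ℝ), (p.2.1 : ℝ), (p.2.2.1 : ℝ)] : EuclideanSpace ℝ (Fin 3)) (WithLp.toLp 2 ![(q.1 : ℝ), (q.2.1 : ℝ), (q.2.2.1 : ℝ)] : EuclideanSpace ℝ (Fin 3)) x =
      (((p.2.1 * q.2.2.1 - p.2.2.1 * q.2.1) : ℤ) : ℝ) * x 0 + (((p.2.2.1 * q.1 - p.1 * q.2.2.1) : ℤ) : ℝ) * x 1 + (((p.1 * q.2.1 - p.2.1 * q.1) : ℤ) : ℝ) * x 2 := by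
  simp [orient3]
  ring

/-- A Pythagorean quadruple `(x, y, z, n)` gives a vector of norm `n`. -/
theorem norm_ivec {p : ℤ × ℤ × ℤ × ℕ} (h : (p.1 * p.1 + p.2.1 * p.2.1 + p.2.2.1 * p.2.2.1) = (p.2.2.2 : ℤ) * p.2.2.2) :
    ‖(WithLp.toLp 2 ![(p.1 : ℝ), (p.2.1 : ℝ), (p.2.2.1 : ℝ)] : EuclideanSpace ℝ (Fin 3))‖ = p.2.2.2 := by
  have h1 : ‖(WithLp.toLp 2 ![(p.1 : ℝ), (p.2.1 : ℝ), (p.2.2.1 : ℝ)] : EuclideanSpace ℝ (Fin 3))‖ ^ 2 = (p.2.2.2 : ℝ) ^ 2 := by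
    have : (((p.1 * p.1 + p.2.1 * p.2.1 + p.2.2.1 * p.2.2.1) : ℤ) : ℝ) = (((p.2.2.2 : ℤ) * p.2.2.2 : ℤ) : ℝ) := by rw [h]
    push_cast at this
    rw [EuclideanSpace.norm_sq_eq]
    simp [Fin.sum_univ_three]
    nlinarith [this]
  exact (pow_left_inj₀ (norm_nonneg _) (Nat.cast_nonneg _) two_ne_zero).1 h1

variable {a b c : ℤ × ℤ × ℤ × ℕ}

/-- **Lower bound for the excess of an integer triangle from an integer certificate**
(denominator `Q = 10¹⁵`): `p² H ≤ 2 Q² G`, `p ≤ 3Q`, `H > 0` give `p/Q ≤ sphExcess`. -/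
theorem le_sphExcess_ivec (ha : (a.1 * a.1 + a.2.1 * a.2.1 + a.2.2.1 * a.2.2.1) = (a.2.2.2 : ℤ) * a.2.2.2)
    (hb : (b.1 * b.1 + b.2.1 * b.2.1 + b.2.2.1 * b.2.2.1) = (b.2.2.2 : ℤ) * b.2.2.2)
    (hc : (c.1 * c.1 + c.2.1 * c.2.1 + c.2.2.1 * c.2.2.1) = (c.2.2.2 : ℤ) * c.2.2.2)
    (ha0 : 0 < a.2.2.2) (hb0 : 0 < b.2.2.2) (hc0 : 0 < c.2.2.2)
    (hdet : (a.1 * (b.2.1 * c.2.2.1 - b.2.2.1 * c.2.1) - a.2.1 * (b.1 * c.2.2.1 - b.2.2.1 * c.1) + a.2.2.1 * (b.1 * c.2.1 - b.2.1 * c.1)) ≠ 0)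
    {p : ℕ} (h : (0 < (((b.2.2.2 : ℤ) * c.2.2.2 + (b.1 * c.1 + b.2.1 * c.2.1 + b.2.2.1 * c.2.2.1)) * ((a.2.2.2
      : ℤ) * c.2.2.2 + (a.1 * c.1 + a.2.1 * c.2.1 + a.2.2.1 * c.2.2.1)) * ((a.2.2.2 : ℤ) * b.2.2.2 +
      (a.1 * b.1 + a.2.1 * b.2.1 + a.2.2.1 * b.2.2.1))) ∧ p ≤ 3 * 10 ^ 15 ∧ (p : ℤ) ^ 2 * (((b.2.2.2
      : ℤ) * c.2.2.2 + (b.1 * c.1 + b.2.1 * c.2.1 + b.2.2.1 * c.2.2.1)) * ((a.2.2.2 : ℤ) * c.2.2.2 +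
      (a.1 * c.1 + a.2.1 * c.2.1 + a.2.2.1 * c.2.2.1)) * ((a.2.2.2 : ℤ) * b.2.2.2 + (a.1 * b.1 +
      a.2.1 * b.2.1 + a.2.2.1 * b.2.2.1))) ≤ 2 * (10 ^ 15) ^ 2 * ((a.2.2.2 : ℤ) ^ 2 * (b.2.2.2 : ℤ)
      ^ 2 * (c.2.2.2 : ℤ) ^ 2 - (a.2.2.2 : ℤ) ^ 2 * (b.1 * c.1 + b.2.1 * c.2.1 + b.2.2.1 * c.2.2.1)
      ^ 2 - (b.2.2.2 : ℤ) ^ 2 * (a.1 * c.1 + a.2.1 * c.2.1 + a.2.2.1 * c.2.2.1) ^ 2 - (c.2.2.2 : ℤ)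
      ^ 2 * (a.1 * b.1 + a.2.1 * b.2.1 + a.2.2.1 * b.2.2.1) ^ 2 + 2 * (b.1 * c.1 + b.2.1 * c.2.1 +
      b.2.2.1 * c.2.2.1) * (a.1 * c.1 + a.2.1 * c.2.1 + a.2.2.1 * c.2.2.1) * (a.1 * b.1 + a.2.1 *
      b.2.1 + a.2.2.1 * b.2.2.1)))) :
    (p : ℝ) / 10 ^ 15 ≤ sphExcess (WithLp.toLp 2 ![(a.1 : ℝ), (a.2.1 : ℝ), (a.2.2.1 : ℝ)] : EuclideanSpace ℝ (Fin 3)) (WithLp.toLp 2 ![(b.1 : ℝ), (b.2.1 : ℝ), (b.2.2.1 : ℝ)] : EuclideanSpace ℝ (Fin 3)) (WithLp.toLp 2 ![(c.1 : ℝ), (c.2.1 : ℝ), (c.2.2.1 : ℝ)] : EuclideanSpace ℝ (Fin 3)) := by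
  obtain ⟨hH, hp, h⟩ := h
  have hH' := Int.cast_lt (R := ℝ) |>.2 hH
  have h' := Int.cast_le (R := ℝ) |>.2 h
  have hp' : (p : ℝ) ≤ 3 * 10 ^ 15 := by exact_mod_cast hp
  refine le_sphExcess_of_norms (Nat.cast_pos.2 ha0) (Nat.cast_pos.2 hb0) (Nat.cast_pos.2 hc0)
    (norm_ivec ha) (norm_ivec hb) (norm_ivec hc) (inner_ivec _ _) (inner_ivec _ _)
    (inner_ivec _ _) (by rw [orient3_ivec]; exact_mod_cast hdet) ?_ ?_ ?_
  · rw [div_le_iff₀ (by positivity)]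
    nlinarith [Real.pi_gt_three]
  · push_cast at hH' ⊢
    linarith
  · push_cast at h' ⊢
    rw [div_pow, div_mul_eq_mul_div, div_le_iff₀ (by positivity)]
    linarith

/-- **Upper bound for the excess of an integer triangle from an integer certificate**
(denominator `Q = 10¹⁵`): positive orientation, `96 Q⁴ G ≤ H (48 p² Q² − 5 p⁴)`, `p ≤ Q`,
`G, H > 0`, `na nb nc + na⟨b,c⟩ + nb⟨a,c⟩ + nc⟨a,b⟩ ≥ 0` give `sphExcess ≤ p/Q` (the facet
clause of the certificate is not used here). -/
theorem sphExcess_ivec_le (ha : (a.1 * a.1 + a.2.1 * a.2.1 + a.2.2.1 * a.2.2.1) = (a.2.2.2 : ℤ) * a.2.2.2)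
    (hb : (b.1 * b.1 + b.2.1 * b.2.1 + b.2.2.1 * b.2.2.1) = (b.2.2.2 : ℤ) * b.2.2.2)
    (hc : (c.1 * c.1 + c.2.1 * c.2.1 + c.2.2.1 * c.2.2.1) = (c.2.2.2 : ℤ) * c.2.2.2)
    (ha0 : 0 < a.2.2.2) (hb0 : 0 < b.2.2.2) (hc0 : 0 < c.2.2.2)
    {p : ℕ} (h : (0 < (a.1 * (b.2.1 * c.2.2.1 - b.2.2.1 * c.2.1) - a.2.1 * (b.1 * c.2.2.1 - b.2.2.1 * c.1) +
      a.2.2.1 * (b.1 * c.2.1 - b.2.1 * c.1)) ∧ (0 < (b.1 * c.2.1 - b.2.1 * c.1) ∧ (1250 ^ 2 - 893 ^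
      2) * ((b.2.1 * c.2.2.1 - b.2.2.1 * c.2.1) ^ 2 + (b.2.2.1 * c.1 - b.1 * c.2.2.1) ^ 2) ≤ 893 ^ 2
      * (b.1 * c.2.1 - b.2.1 * c.1) ^ 2) ∧ 0 < ((a.2.2.2 : ℤ) ^ 2 * (b.2.2.2 : ℤ) ^ 2 * (c.2.2.2 :
      ℤ) ^ 2 - (a.2.2.2 : ℤ) ^ 2 * (b.1 * c.1 + b.2.1 * c.2.1 + b.2.2.1 * c.2.2.1) ^ 2 - (b.2.2.2 :
      ℤ) ^ 2 * (a.1 * c.1 + a.2.1 * c.2.1 + a.2.2.1 * c.2.2.1) ^ 2 - (c.2.2.2 : ℤ) ^ 2 * (a.1 * b.1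
      + a.2.1 * b.2.1 + a.2.2.1 * b.2.2.1) ^ 2 + 2 * (b.1 * c.1 + b.2.1 * c.2.1 + b.2.2.1 * c.2.2.1)
      * (a.1 * c.1 + a.2.1 * c.2.1 + a.2.2.1 * c.2.2.1) * (a.1 * b.1 + a.2.1 * b.2.1 + a.2.2.1 *
      b.2.2.1)) ∧ 0 < (((b.2.2.2 : ℤ) * c.2.2.2 + (b.1 * c.1 + b.2.1 * c.2.1 + b.2.2.1 * c.2.2.1)) *
      ((a.2.2.2 : ℤ) * c.2.2.2 + (a.1 * c.1 + a.2.1 * c.2.1 + a.2.2.1 * c.2.2.1)) * ((a.2.2.2 : ℤ) *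
      b.2.2.2 + (a.1 * b.1 + a.2.1 * b.2.1 + a.2.2.1 * b.2.2.1))) ∧ 0 ≤ ((a.2.2.2 : ℤ) * b.2.2.2 *
      c.2.2.2 + a.2.2.2 * (b.1 * c.1 + b.2.1 * c.2.1 + b.2.2.1 * c.2.2.1) + b.2.2.2 * (a.1 * c.1 +
      a.2.1 * c.2.1 + a.2.2.1 * c.2.2.1) + c.2.2.2 * (a.1 * b.1 + a.2.1 * b.2.1 + a.2.2.1 *
      b.2.2.1)) ∧ p ≤ 10 ^ 15 ∧ 96 * (10 ^ 15) ^ 4 * ((a.2.2.2 : ℤ) ^ 2 * (b.2.2.2 : ℤ) ^ 2 *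
      (c.2.2.2 : ℤ) ^ 2 - (a.2.2.2 : ℤ) ^ 2 * (b.1 * c.1 + b.2.1 * c.2.1 + b.2.2.1 * c.2.2.1) ^ 2 -
      (b.2.2.2 : ℤ) ^ 2 * (a.1 * c.1 + a.2.1 * c.2.1 + a.2.2.1 * c.2.2.1) ^ 2 - (c.2.2.2 : ℤ) ^ 2 *
      (a.1 * b.1 + a.2.1 * b.2.1 + a.2.2.1 * b.2.2.1) ^ 2 + 2 * (b.1 * c.1 + b.2.1 * c.2.1 + b.2.2.1
      * c.2.2.1) * (a.1 * c.1 + a.2.1 * c.2.1 + a.2.2.1 * c.2.2.1) * (a.1 * b.1 + a.2.1 * b.2.1 +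
      a.2.2.1 * b.2.2.1)) ≤ (((b.2.2.2 : ℤ) * c.2.2.2 + (b.1 * c.1 + b.2.1 * c.2.1 + b.2.2.1 *
      c.2.2.1)) * ((a.2.2.2 : ℤ) * c.2.2.2 + (a.1 * c.1 + a.2.1 * c.2.1 + a.2.2.1 * c.2.2.1)) *
      ((a.2.2.2 : ℤ) * b.2.2.2 + (a.1 * b.1 + a.2.1 * b.2.1 + a.2.2.1 * b.2.2.1))) * (48 * (p : ℤ) ^
      2 * (10 ^ 15) ^ 2 - 5 * (p : ℤ) ^ 4))) :
    sphExcess (WithLp.toLp 2 ![(a.1 : ℝ), (a.2.1 : ℝ), (a.2.2.1 : ℝ)] : EuclideanSpace ℝ (Fin 3)) (WithLp.toLp 2 ![(b.1 : ℝ), (b.2.1 : ℝ), (b.2.2.1 : ℝ)] : EuclideanSpace ℝ (Fin 3)) (WithLp.toLp 2 ![(c.1 : ℝ), (c.2.1 : ℝ), (c.2.2.1 : ℝ)] : EuclideanSpace ℝ (Fin 3)) ≤ (p : ℝ) / 10 ^ 15 := by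
  obtain ⟨hdet, -, hG, hH, hsum, hp, h⟩ := h
  have hG' := Int.cast_lt (R := ℝ) |>.2 hG
  have hH' := Int.cast_lt (R := ℝ) |>.2 hH
  have hsum' := Int.cast_le (R := ℝ) |>.2 hsum
  have h' := Int.cast_le (R := ℝ) |>.2 h
  have hp' : (p : ℝ) ≤ 10 ^ 15 := by exact_mod_cast hp
  refine sphExcess_le_of_norms (Nat.cast_pos.2 ha0) (Nat.cast_pos.2 hb0) (Nat.cast_pos.2 hc0)
    (norm_ivec ha) (norm_ivec hb) (norm_ivec hc) (inner_ivec _ _) (inner_ivec _ _)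
    (inner_ivec _ _) (by rw [orient3_ivec]; exact_mod_cast hdet.ne') (by positivity) ?_ ?_ ?_ ?_ ?_
  · rwa [div_le_one (by positivity)]
  · push_cast at hsum' ⊢
    linarith
  · push_cast at hG' ⊢
    linarith
  · push_cast at hH' ⊢
    linarith
  · push_cast at h' ⊢
    have e : (48 * ((p : ℝ) / 10 ^ 15) ^ 2 - 5 * ((p : ℝ) / 10 ^ 15) ^ 4) =
        (48 * (p : ℝ) ^ 2 * (10 ^ 15) ^ 2 - 5 * (p : ℝ) ^ 4) / (10 ^ 15) ^ 4 := by
      rw [div_pow, div_pow, eq_div_iff (by positivity)]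
      field_simp
    rw [e, mul_div_assoc', le_div_iff₀ (by positivity)]
    linarith

end IntVec

/-- **Registered sub-goal `stub_censusCertFan`** (worker K2a's split of `stub_censusCert`, file
1/4): the spherical excess is invariant under positive rescaling of the three generators. -/
theorem stub_censusCertFan : ∀ (a b c : EuclideanSpace ℝ (Fin 3)) (r s t : ℝ), 0 < r → 0 < s → 0 < t → Literature.Geometry.DiscreteGeometry.sphExcess (r • a) (s • b) (t • c) = Literature.Geometry.DiscreteGeometry.sphExcess a b c :=
  fun a b c _ _ _ hr hs ht => sphExcess_smul a b c hr hs ht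

end Summit.AtomisticToContinuum.Crystallization.Theorems.ZeroDefectDensityBirth
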